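import Mathlib.LinearAlgebra.Matrix.PosDef
import Literature.Barriers.CriticalPhenomena.RigorousRGSmallParameterFracLaplacian
import HarnessLib

/-!
# `RigorousRGSmallParameter` (Slade, Theorem 1.4.1): §2.2.2–§2.2.3 PROVED — the torus generator
# `-(-Δ_Λ)^β` (signs, `(-Δ_Λ)^β + m² ≻ 0`), Lemma 2.2.2 (torus inverses by periodisation), the
# `ℤ^d` resolvent `((-Δ)^β + m²)⁻¹` and display (2.19) (torus resolvent = periodised resolvent)

Companion of `RigorousRGSmallParameterFracLaplacian.lean` (Lemma 2.2.1 proved, rows of `(-Δ)^β`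
absolutely summable, `fracLaplacianTorus` a genuine sum with vanishing row sums) in the proof
architecture of the barrier `RigorousRGSmallParameter.lean`. Source: G. Slade, *Critical
exponents for long-range `O(n)` models below the upper critical dimension*, CMP 358 (2018),
arXiv:1611.06169, §2.1.2 (resolvent; last display `((-Δ)^β + m²)⁻¹𝟙 = m⁻²𝟙`), §2.2.2 ("Markov
chain on torus"), §2.2.3 ("Torus resolvents": display (2.19) and Lemma 2.2.2) — arXiv pp. 10–11 —
and §4.1 (the Gaussian measure `P_C`, "`C = ((-Δ_{Λ_N})^{α/2} + m²)⁻¹`").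

## What the source prints

* §2.2.2: "`-(-Δ_{Λ_N})^β_{x,y} = -Σ_{z∈ℤ^d} (-Δ_{ℤ^d})^β_{x,y+zL^N}` … The fact that
  `-(-Δ_{Λ_N})^β` is indeed a generator can be concluded from [this] and Lemma 2.2.1."
* §2.2.3, (2.19): "By Lemma 2.2.2 below (with `T = -Δ+m²` and `T = (-Δ)^β+m²`), the torus
  resolvents … are the inverse matrices given by
  `((-Δ_{Λ_N})^β + m²)⁻¹_{x,y} = Σ_{z∈ℤ^d} ((-Δ_{ℤ^d})^β + m²)⁻¹_{x,y+zL^N}`."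
* **Lemma 2.2.2.** "Let `T = (T_{x',y'})_{x',y'∈ℤ^d}` be a matrix `T : ℓ^∞(ℤ^d) → ℓ^∞(ℤ^d)`
  satisfying `T_{x'+z',y'+z'} = T_{x',y'}` for all `x',y',z' ∈ ℤ^d`, with inverse matrix
  `T⁻¹ : ℓ^∞(ℤ^d) → ℓ^∞(ℤ^d)`. Define `(T̂_{x,y})_{x,y∈Λ}` by `T̂_{x,y} = Σ_{y'~y} T_{x,y'}` … Then
  `T̂` has inverse matrix `T̂⁻¹_{x,y} = Σ_{y'~y} T⁻¹_{x,y'}`." Printed proof: "The assumed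
  translation invariance for `T` implies the same for `T⁻¹`", then
  `Σ_{y∈Λ} T̂_{x,y} Ŝ_{y,z} = Σ_{y∈Λ}Σ_{y'~y} T_{x,y'} Σ_{z''~z} T⁻¹_{y',z''} = Σ_{z''~z} δ_{x,z''}
  = δ_{x,z}`.
* §2.1.2, last display: "`((-Δ)^β + m²)⁻¹𝟙 = … = m⁻²𝟙`" (used as "`C𝟙 = m⁻²𝟙`" in the
  proof of Lemma 8.2.1).

## What this file proves (everything; no named fact is introduced)

* `hasSum_swap_of_nonneg`, `hasSum_swap_of_abs_le` — Fubini for (dominated) double families,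
  the tool behind every rearrangement below.
* §2.2.2, the torus generator: `fracLaplacianTorus_neg` (`((-Δ_Λ)^β)_{x,y} < 0`, `x ≠ y`),
  `fracLaplacianTorus_self_nonneg`, and — with the symmetry and the vanishing row sums of the
  sibling files — `fracLaplacianTorus_quadForm_nonneg`:
  `Σ_{x,y} v_x((-Δ_Λ)^β)_{x,y}v_y = ½Σ_{x,y}(-((-Δ_Λ)^β)_{x,y})(v_x - v_y)² ≥ 0`.
* The matrix `covInvMatrix d β M m² = (-Δ_Λ)^β + m²I` (`C⁻¹` of §4.1 with `β = α/2`):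
  **positive definite for `m² > 0`** (`posDef_covInvMatrix`, Mathlib `Matrix.PosDef`), hence
  invertible with positive definite inverse `C` (`posDef_covInvMatrix_inv`); `(v,C⁻¹v) ≥ m²|v|²`
  (`le_dotProduct_covInvMatrix_mulVec`) and, for the component-decoupled form `covInvForm` of
  `RigorousRGSmallParameterSusceptibilityFormula.lean`, `(ζ,C⁻¹ζ) ≥ m²Σ_x|ζ_x|²`
  (`le_covInvForm`: the weight `e^{-½(ζ,C⁻¹ζ)}` of `E_C` is a genuine, normalisable Gaussian);
  `C⁻¹𝟙 = m²𝟙` and **`C𝟙 = m⁻²𝟙`** (`covInvMatrix_inv_mulVec_one`).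
* §2.2.3: the periodisation `periodise M K` of a matrix on `ℤ^d` (`fracLaplacianTorus` is
  `periodise M (fracLaplacianZd d β)` by `rfl`), independence of representatives for
  translation-invariant `K` (`periodise_eq_tsum_of_rep`), `periodise_delta`, additivity;
  `inverse_transInv` — the bounded two-sided inverse of a translation-invariant matrix is
  translation invariant (uniqueness of the inverse, by an absolutely convergent reassociation);
  and **`Slade2017_lem222` — Lemma 2.2.2 PROVED**: `T̂Ŝ = 1` and `ŜT̂ = 1` as matrices over the
  torus, for `T` translation invariant with absolutely summable rows and `S` with uniformly
  absolutely summable rows, `TS = ST = I` (rendering of "`T, T⁻¹ : ℓ^∞ → ℓ^∞`").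
* §2.1.2/§2.2.1: the `ℤ^d` resolvent `fracResolventZd d β m²` for `m² > 0`, constructed by the
  Neumann series of the jump chain of Lemma 2.2.1 — `(-Δ)^β = κ(I - P)`, `κ = ((-Δ)^β)_{0,0} > 0`,
  `P ≥ 0` symmetric stochastic (`jumpKernel`, `hasSum_jumpKernel`), `Pⁿ` stochastic
  (`jumpKernelPow_spec`, both recursions `PPⁿ = PⁿP`), `R = (κ+m²)⁻¹Σ_n (κ/(κ+m²))ⁿPⁿ`: entries
  positive (`fracResolventZd_pos`), **row sums `1/m²`** (`hasSum_fracResolventZd_row`, the `ℤ^d`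
  form of `((-Δ)^β+m²)⁻¹𝟙 = m⁻²𝟙`), symmetric, translation invariant, and
  **`((-Δ)^β + m²)R = R((-Δ)^β + m²) = I`** with absolutely convergent matrix products
  (`hasSum_fracLaplacianZd_mul_resolvent`, `hasSum_resolvent_mul_fracLaplacianZd`).
* **Display (2.19) PROVED** (`Slade2017_torusResolvent`): `((-Δ_Λ)^β + m²)⁻¹ =
  periodise M R`, i.e. `(covInvMatrix d β M m²)⁻¹ = Matrix.of (periodise M (fracResolventZd d β m²))`,
  for `d ≥ 1`, `β ∈ (0,1)`, `m² > 0` and every period `M ≥ 1` (the paper's `M = L^N`); whence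
  the entries of `C` are positive (`covInvMatrix_inv_pos`) and `Σ_y C_{x,y} = 1/m²`.

Not treated: the Fourier formula (2.13) for the `ℤ^d` resolvent (the resolvent is built from the
jump chain instead and identified as THE bounded inverse), the massless case `m² = 0`, the
nearest-neighbour line of (2.19), the subordination formula (2.20)/Proposition 2.1.3. Ledger
effect: none on the trust base of the barrier's reduction chain (`Slade2017_prop822`); these are
inputs of the covariance decomposition of §3 and of the Gaussian integration `E_C` of §4.1.
-/

noncomputable section

namespace Literature.Barriers.CriticalPhenomena

open _root_.MeasureTheory Finset Filter Literature.Probability.LatticeModels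
open scoped _root_.Topology BigOperators Matrix

namespace LongRangePhi4

variable {d : ℕ}

/-! ### A Fubini lemma for nonnegative double families -/

/-- **Fubini for nonnegative double families.** If every row `f i ·` has sum `a i` and `Σ_i a i`
converges to `s`, then every column is summable and the column sums have sum `s`. [folklore] -/
theorem hasSum_swap_of_nonneg {ι κ : Type*} {f : ι → κ → ℝ} (hf : ∀ i k, 0 ≤ f i k)
    {a : ι → ℝ} (ha : ∀ i, HasSum (f i) (a i)) {s : ℝ} (hs : HasSum a s) :
    (∀ k, Summable fun i => f i k) ∧ HasSum (fun k => ∑' i, f i k) s := by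
  have hF : Summable (Function.uncurry f) := by
    refine (summable_prod_of_nonneg fun p => hf p.1 p.2).2 ⟨fun i => (ha i).summable, ?_⟩
    have : (fun i => ∑' k, f i k) = a := funext fun i => (ha i).tsum_eq
    show Summable fun i => ∑' k, f i k
    rw [this]
    exact hs.summable
  have htot : HasSum (Function.uncurry f) s := by
    have h1 : HasSum a (∑' p, Function.uncurry f p) := hF.hasSum.prod_fiberwise fun i => ha i
    rw [← h1.unique hs]
    exact hF.hasSum
  have hF' : Summable fun q : κ × ι => Function.uncurry f q.swap := hF.prod_symm
  have hcol : ∀ k, Summable fun i => f i k := fun k =>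
    hF'.comp_injective (Prod.mk_right_injective k)
  refine ⟨hcol, ?_⟩
  have htot' : HasSum (fun q : κ × ι => Function.uncurry f q.swap) s := by
    have e : ∑' q : κ × ι, Function.uncurry f q.swap = ∑' p, Function.uncurry f p :=
      (Equiv.prodComm κ ι).tsum_eq (Function.uncurry f)
    rw [← htot.tsum_eq, ← e]
    exact hF'.hasSum
  exact htot'.prod_fiberwise fun k => (hcol k).hasSum

/-- Fubini for a double family dominated by a nonnegative product-summable one: if
`|g i k| ≤ f i k` with `f` as in `hasSum_swap_of_nonneg`, then `Σ_i Σ_k g = Σ_k Σ_i g`, all sums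
converging absolutely. Stated with `HasSum`. [folklore] -/
theorem hasSum_swap_of_abs_le {ι κ : Type*} {f g : ι → κ → ℝ} (hfg : ∀ i k, |g i k| ≤ f i k)
    {a : ι → ℝ} (ha : ∀ i, HasSum (f i) (a i)) {s : ℝ} (hs : HasSum a s)
    {b : ι → ℝ} (hb : ∀ i, HasSum (g i) (b i)) {t : ℝ} (ht : HasSum b t) :
    (∀ k, Summable fun i => g i k) ∧ HasSum (fun k => ∑' i, g i k) t := by
  have hf : ∀ i k, 0 ≤ f i k := fun i k => (abs_nonneg _).trans (hfg i k)
  have hF : Summable (Function.uncurry f) := by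
    refine (summable_prod_of_nonneg fun p => hf p.1 p.2).2 ⟨fun i => (ha i).summable, ?_⟩
    have : (fun i => ∑' k, f i k) = a := funext fun i => (ha i).tsum_eq
    show Summable fun i => ∑' k, f i k
    rw [this]
    exact hs.summable
  have hG : Summable (Function.uncurry g) :=
    Summable.of_norm_bounded hF fun p => by
      rw [Real.norm_eq_abs]
      exact hfg p.1 p.2
  have htot : HasSum (Function.uncurry g) t := by
    have h1 : HasSum b (∑' p, Function.uncurry g p) := hG.hasSum.prod_fiberwise fun i => hb i
    rw [← h1.unique ht]
    exact hG.hasSum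
  have hG' : Summable fun q : κ × ι => Function.uncurry g q.swap := hG.prod_symm
  have hcol : ∀ k, Summable fun i => g i k := fun k =>
    hG'.comp_injective (Prod.mk_right_injective k)
  refine ⟨hcol, ?_⟩
  have htot' : HasSum (fun q : κ × ι => Function.uncurry g q.swap) t := by
    have e : ∑' q : κ × ι, Function.uncurry g q.swap = ∑' p, Function.uncurry g p :=
      (Equiv.prodComm κ ι).tsum_eq (Function.uncurry g)
    rw [← htot.tsum_eq, ← e]
    exact hG'.hasSum
  exact htot'.prod_fiberwise fun k => (hcol k).hasSum

/-! ### §2.2.2: signs of the torus generator and positivity of `(-Δ_Λ)^β + m²` -/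

/-- A lattice vector `ỹ + Mz` (with `ỹ` the `ZMod.val` representative of a torus point `y`) is the
representative `x̃` of `x` only if `x = y`. [folklore] -/
theorem torus_eq_of_rep_eq {M : ℕ} [NeZero M] {x y : TorusSite d M} {z : Site d}
    (h : (fun j => ((y j).val : ℤ) + M * z j) = fun j => ((x j).val : ℤ)) : x = y := by
  funext j
  have hj := congr_fun h j
  have hc : ((((y j).val : ℤ) + (M : ℤ) * z j : ℤ) : ZMod M) = (((x j).val : ℤ) : ZMod M) := by
    rw [hj]
  push_cast at hc
  rw [ZMod.natCast_zmod_val, ZMod.natCast_zmod_val, ZMod.natCast_self, zero_mul, add_zero] at hc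
  exact hc.symm

/-- **Off-diagonal entries of the torus generator are negative**: `((-Δ_Λ)^β)_{x,y} < 0` for
`x ≠ y` (`d ≥ 1`, `β ∈ (0,1)`, any period `M ≥ 1`) — every term of the periodisation sum is an
off-diagonal entry of `(-Δ_{ℤ^d})^β`, negative by Lemma 2.2.1.
[cite: Slade2017, §2.2.2 (torus generator) and Lemma 2.2.1] -/
theorem fracLaplacianTorus_neg (hd : 1 ≤ d) {β : ℝ} (hβ0 : 0 < β) (hβ1 : β < 1) {M : ℕ}
    [NeZero M] {x y : TorusSite d M} (hxy : x ≠ y) : fracLaplacianTorus d β M x y < 0 := by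
  have h := hasSum_fracLaplacianTorus hd hβ0 hβ1 x y
  have hterm : ∀ z : Site d, fracLaplacianZd d β (fun j => ((x j).val : ℤ))
      (fun j => ((y j).val : ℤ) + M * z j) < 0 := fun z =>
    fracLaplacianZd_neg hd hβ0 hβ1 fun heq => hxy (torus_eq_of_rep_eq heq)
  have hle := le_hasSum h.neg 0 fun z _ => (neg_nonneg.2 (hterm z).le)
  have h0 := hterm 0
  linarith

/-- Off-diagonal entries of the torus generator are nonpositive. [cite: Slade2017, §2.2.2] -/
theorem fracLaplacianTorus_nonpos (hd : 1 ≤ d) {β : ℝ} (hβ0 : 0 < β) (hβ1 : β < 1) {M : ℕ}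
    [NeZero M] {x y : TorusSite d M} (hxy : x ≠ y) : fracLaplacianTorus d β M x y ≤ 0 :=
  (fracLaplacianTorus_neg hd hβ0 hβ1 hxy).le

/-- **Diagonal entries of the torus generator are nonnegative**: `((-Δ_Λ)^β)_{x,x} =
-Σ_{y ≠ x} ((-Δ_Λ)^β)_{x,y} ≥ 0` (row sums vanish). [cite: Slade2017, §2.2.2] -/
theorem fracLaplacianTorus_self_nonneg (hd : 1 ≤ d) {β : ℝ} (hβ0 : 0 < β) (hβ1 : β < 1)
    {M : ℕ} [NeZero M] (x : TorusSite d M) : 0 ≤ fracLaplacianTorus d β M x x := by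
  have h := fracLaplacianTorus_rowSum hd hβ0 hβ1 x
  rw [← Finset.add_sum_erase _ _ (Finset.mem_univ x)] at h
  have hs : ∑ y ∈ Finset.univ.erase x, fracLaplacianTorus d β M x y ≤ 0 :=
    Finset.sum_nonpos fun y hy =>
      fracLaplacianTorus_nonpos hd hβ0 hβ1 (Finset.ne_of_mem_erase hy).symm
  linarith

/-- The quadratic form of a symmetric kernel with vanishing row sums is a sum of squares of
differences: `Σ_{x,y} A_{xy} v_x v_y = -½ Σ_{x,y} A_{xy}(v_x - v_y)²`. [folklore] -/
theorem sum_sum_mul_mul_eq_of_symm_rowSum {ι : Type*} [Fintype ι] (A : ι → ι → ℝ)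
    (hsymm : ∀ x y, A x y = A y x) (hrow : ∀ x, ∑ y, A x y = 0) (v : ι → ℝ) :
    ∑ x, ∑ y, A x y * (v x * v y) = -(1 / 2) * ∑ x, ∑ y, A x y * (v x - v y) ^ 2 := by
  have h1 : ∑ x, ∑ y, A x y * v x ^ 2 = 0 := by
    have : ∀ x, ∑ y, A x y * v x ^ 2 = (∑ y, A x y) * v x ^ 2 := fun x => by
      rw [Finset.sum_mul]
    simp_rw [this, hrow, zero_mul, Finset.sum_const_zero]
  have h2 : ∑ x, ∑ y, A x y * v y ^ 2 = 0 := by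
    rw [Finset.sum_comm]
    have : ∀ y, ∑ x, A x y * v y ^ 2 = (∑ x, A y x) * v y ^ 2 := fun y => by
      rw [Finset.sum_mul]
      exact Finset.sum_congr rfl fun x _ => by rw [hsymm]
    simp_rw [this, hrow, zero_mul, Finset.sum_const_zero]
  have h3 : ∀ x y, A x y * (v x - v y) ^ 2 =
      A x y * v x ^ 2 + A x y * v y ^ 2 - 2 * (A x y * (v x * v y)) := fun x y => by ring
  simp_rw [h3, Finset.sum_sub_distrib, Finset.sum_add_distrib, ← Finset.mul_sum, h1, h2]
  ring

/-- **`(-Δ_Λ)^β` is positive semidefinite**: `Σ_{x,y} v_x ((-Δ_Λ)^β)_{xy} v_y =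
½ Σ_{x,y} (-((-Δ_Λ)^β)_{xy})(v_x - v_y)² ≥ 0` (symmetric, vanishing row sums, nonpositive
off-diagonal entries). [cite: Slade2017, §2.2.2 and §1.2 ("real symmetric matrix M")] -/
theorem fracLaplacianTorus_quadForm_nonneg (hd : 1 ≤ d) {β : ℝ} (hβ0 : 0 < β) (hβ1 : β < 1)
    {M : ℕ} [NeZero M] (v : TorusSite d M → ℝ) :
    0 ≤ ∑ x, ∑ y, fracLaplacianTorus d β M x y * (v x * v y) := by
  rw [sum_sum_mul_mul_eq_of_symm_rowSum (fracLaplacianTorus d β M)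
    (fun x y => fracLaplacianTorus_comm β x y) (fun x => fracLaplacianTorus_rowSum hd hβ0 hβ1 x) v]
  have : ∑ x, ∑ y, fracLaplacianTorus d β M x y * (v x - v y) ^ 2 ≤ 0 := by
    refine Finset.sum_nonpos fun x _ => Finset.sum_nonpos fun y _ => ?_
    by_cases hxy : x = y
    · subst hxy; simp
    · exact mul_nonpos_of_nonpos_of_nonneg (fracLaplacianTorus_nonpos hd hβ0 hβ1 hxy)
        (sq_nonneg _)
  linarith

/-- The matrix `C⁻¹ = (-Δ_Λ)^β + m²` on `ℝ^Λ`, `Λ = (ℤ/Mℤ)^d` (Slade §4.1: "`C =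
((-Δ_{Λ_N})^{α/2} + m²)⁻¹`", here with `β = α/2` and any period `M`).
[cite: Slade2017, §2.2.3 (torus resolvents) and §4.1 (covariance C)] -/
def covInvMatrix (d : ℕ) (β : ℝ) (M : ℕ) [NeZero M] (m2 : ℝ) :
    Matrix (TorusSite d M) (TorusSite d M) ℝ :=
  Matrix.of (fracLaplacianTorus d β M) + m2 • (1 : Matrix (TorusSite d M) (TorusSite d M) ℝ)

/-- Entries of `C⁻¹`: `((-Δ_Λ)^β)_{xy} + m²𝟙{x=y}`. [cite: Slade2017, §4.1] -/
theorem covInvMatrix_apply {M : ℕ} [NeZero M] (β m2 : ℝ) (x y : TorusSite d M) :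
    covInvMatrix d β M m2 x y = fracLaplacianTorus d β M x y + if x = y then m2 else 0 := by
  simp [covInvMatrix, Matrix.one_apply]

/-- `C⁻¹` acting on a vector: `(C⁻¹v)_x = Σ_y ((-Δ_Λ)^β)_{xy} v_y + m² v_x`. [cite: Slade2017, §4.1] -/
theorem covInvMatrix_mulVec {M : ℕ} [NeZero M] (β m2 : ℝ) (v : TorusSite d M → ℝ)
    (x : TorusSite d M) :
    (covInvMatrix d β M m2 *ᵥ v) x = ∑ y, fracLaplacianTorus d β M x y * v y + m2 * v x := by
  simp only [covInvMatrix, Matrix.add_mulVec, Pi.add_apply, Matrix.smul_mulVec,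
    Matrix.one_mulVec, Pi.smul_apply, smul_eq_mul]
  rfl

/-- `C⁻¹` is a symmetric (real Hermitian) matrix. [cite: Slade2017, §1.2 ("real symmetric matrix")] -/
theorem isHermitian_covInvMatrix {M : ℕ} [NeZero M] (β m2 : ℝ) :
    (covInvMatrix d β M m2).IsHermitian := by
  refine Matrix.IsHermitian.ext fun x y => ?_
  rw [star_trivial, covInvMatrix_apply, covInvMatrix_apply, fracLaplacianTorus_comm]
  by_cases h : x = y
  · subst h; rfl
  · rw [if_neg h, if_neg (Ne.symm h)]

/-- The quadratic form of `C⁻¹`: `(v, C⁻¹v) = Σ_{x,y} v_x((-Δ_Λ)^β)_{xy}v_y + m²Σ_x v_x²`.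
[cite: Slade2017, §4.1] -/
theorem dotProduct_covInvMatrix_mulVec {M : ℕ} [NeZero M] (β m2 : ℝ) (v : TorusSite d M → ℝ) :
    v ⬝ᵥ (covInvMatrix d β M m2 *ᵥ v) =
      ∑ x, ∑ y, fracLaplacianTorus d β M x y * (v x * v y) + m2 * ∑ x, v x ^ 2 := by
  simp only [dotProduct, covInvMatrix_mulVec, mul_add, Finset.sum_add_distrib, Finset.mul_sum]
  congr 1
  · refine Finset.sum_congr rfl fun x _ => Finset.sum_congr rfl fun y _ => ?_
    ring
  · refine Finset.sum_congr rfl fun x _ => ?_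
    ring

/-- **`C⁻¹ = (-Δ_Λ)^β + m²` is bounded below by `m²`**: `(v, C⁻¹v) ≥ m² Σ_x v_x²`
(`d ≥ 1`, `β ∈ (0,1)`). [cite: Slade2017, §2.2.2–§2.2.3] -/
theorem le_dotProduct_covInvMatrix_mulVec (hd : 1 ≤ d) {β : ℝ} (hβ0 : 0 < β) (hβ1 : β < 1)
    {M : ℕ} [NeZero M] (m2 : ℝ) (v : TorusSite d M → ℝ) :
    m2 * ∑ x, v x ^ 2 ≤ v ⬝ᵥ (covInvMatrix d β M m2 *ᵥ v) := by
  rw [dotProduct_covInvMatrix_mulVec]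
  have := fracLaplacianTorus_quadForm_nonneg hd hβ0 hβ1 v
  linarith

/-- **`C⁻¹ = (-Δ_Λ)^β + m²` is positive definite** for `m² > 0` (`d ≥ 1`, `β ∈ (0,1)`, any
period `M ≥ 1`), so that the Gaussian measure `P_C` of §4.1 with covariance
`C = ((-Δ_Λ)^{α/2} + m²)⁻¹` exists. [cite: Slade2017, §2.2.3 and §4.1 (covariance C)] -/
theorem posDef_covInvMatrix (hd : 1 ≤ d) {β : ℝ} (hβ0 : 0 < β) (hβ1 : β < 1) {M : ℕ}
    [NeZero M] {m2 : ℝ} (hm2 : 0 < m2) : (covInvMatrix d β M m2).PosDef := by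
  refine Matrix.PosDef.of_dotProduct_mulVec_pos (isHermitian_covInvMatrix β m2) fun v hv => ?_
  rw [star_trivial]
  have hle := le_dotProduct_covInvMatrix_mulVec hd hβ0 hβ1 m2 v
  have hpos : 0 < ∑ x, v x ^ 2 := by
    obtain ⟨x, hx⟩ : ∃ x, v x ≠ 0 := by
      by_contra hall
      push Not at hall
      exact hv (funext hall)
    exact lt_of_lt_of_le (by positivity) (Finset.single_le_sum (fun y _ => sq_nonneg (v y))
      (Finset.mem_univ x))
  nlinarith

/-- `C⁻¹` is invertible (`m² > 0`). [cite: Slade2017, §2.2.3] -/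
theorem isUnit_covInvMatrix (hd : 1 ≤ d) {β : ℝ} (hβ0 : 0 < β) (hβ1 : β < 1) {M : ℕ}
    [NeZero M] {m2 : ℝ} (hm2 : 0 < m2) : IsUnit (covInvMatrix d β M m2) :=
  (posDef_covInvMatrix hd hβ0 hβ1 hm2).isUnit

/-- The covariance `C = ((-Δ_Λ)^β + m²)⁻¹` is positive definite (`m² > 0`).
[cite: Slade2017, §4.1 (covariance C)] -/
theorem posDef_covInvMatrix_inv (hd : 1 ≤ d) {β : ℝ} (hβ0 : 0 < β) (hβ1 : β < 1) {M : ℕ}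
    [NeZero M] {m2 : ℝ} (hm2 : 0 < m2) : (covInvMatrix d β M m2)⁻¹.PosDef :=
  (posDef_covInvMatrix hd hβ0 hβ1 hm2).inv

/-- Row sums of `C⁻¹`: `((-Δ_Λ)^β + m²)𝟙 = m²𝟙`. [cite: Slade2017, §2.1.2 (last display) and §2.2.2] -/
theorem covInvMatrix_mulVec_one (hd : 1 ≤ d) {β : ℝ} (hβ0 : 0 < β) (hβ1 : β < 1) {M : ℕ}
    [NeZero M] (m2 : ℝ) : covInvMatrix d β M m2 *ᵥ (fun _ => (1 : ℝ)) = fun _ => m2 := by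
  funext x
  rw [covInvMatrix_mulVec]
  simp only [mul_one]
  rw [fracLaplacianTorus_rowSum hd hβ0 hβ1 x, zero_add]

/-- **`C𝟙 = m⁻²𝟙` on the torus**: `((-Δ_Λ)^β + m²)⁻¹𝟙 = m⁻²𝟙` (the identity "`C𝟙 = m⁻²𝟙`"
used in the proof of Lemma 8.2.1; torus form of the last display of §2.1.2), for `m² > 0`,
`d ≥ 1`, `β ∈ (0,1)`. [cite: Slade2017, §2.1.2 (last display); Lemma 8.2.1 (proof, "C𝟙 = m⁻²𝟙")] -/
theorem covInvMatrix_inv_mulVec_one (hd : 1 ≤ d) {β : ℝ} (hβ0 : 0 < β) (hβ1 : β < 1) {M : ℕ}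
    [NeZero M] {m2 : ℝ} (hm2 : 0 < m2) :
    (covInvMatrix d β M m2)⁻¹ *ᵥ (fun _ => (1 : ℝ)) = fun _ => m2⁻¹ := by
  have hU : IsUnit (covInvMatrix d β M m2).det :=
    (Matrix.isUnit_iff_isUnit_det _).1 (isUnit_covInvMatrix hd hβ0 hβ1 hm2)
  have h1 : (covInvMatrix d β M m2)⁻¹ *ᵥ (covInvMatrix d β M m2 *ᵥ fun _ => (1 : ℝ)) =
      fun _ => (1 : ℝ) := by
    rw [Matrix.mulVec_mulVec, Matrix.nonsing_inv_mul _ hU, Matrix.one_mulVec]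
  rw [covInvMatrix_mulVec_one hd hβ0 hβ1 m2] at h1
  have h2 : (fun _ : TorusSite d M => m2) = m2 • fun _ : TorusSite d M => (1 : ℝ) := by
    funext x; simp
  rw [h2, Matrix.mulVec_smul] at h1
  have h3 := congr_arg (fun w : TorusSite d M → ℝ => m2⁻¹ • w) h1
  simp only [smul_smul, inv_mul_cancel₀ hm2.ne', one_smul] at h3
  rw [h3]
  funext x
  simp

/-- The quadratic form `covInvForm` of the sibling file (components decoupled) is the quadratic
form of the matrix `C⁻¹`, component by component. [cite: Slade2017, §4.1 (Gaussian measure P_C)] -/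
theorem covInvForm_eq_sum_dotProduct {M n : ℕ} [NeZero M] (α m2 : ℝ)
    (ζ : TorusSite d M → Fin n → ℝ) :
    covInvForm d M n α m2 ζ =
      ∑ i, (fun x => ζ x i) ⬝ᵥ (covInvMatrix d (α / 2) M m2 *ᵥ fun x => ζ x i) := by
  unfold covInvForm
  rw [Finset.sum_comm]
  refine Finset.sum_congr rfl fun i _ => ?_
  simp only [dotProduct, covInvMatrix_mulVec]

/-- **The Gaussian weight of `E_C` is a genuine Gaussian**: `(ζ, C⁻¹ζ) ≥ m² Σ_{x,i} (ζ_xⁱ)²`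
for the long-range model (`d ≥ 1`, `α ∈ (0,2)`), so `e^{-½(ζ,C⁻¹ζ)}` is dominated by a product
Gaussian. [cite: Slade2017, §4.1 (Gaussian measure P_C)] -/
theorem le_covInvForm (hd : 1 ≤ d) {M n : ℕ} [NeZero M] {α : ℝ} (hα0 : 0 < α) (hα2 : α < 2)
    (m2 : ℝ) (ζ : TorusSite d M → Fin n → ℝ) :
    m2 * ∑ x, sqNorm (ζ x) ≤ covInvForm d M n α m2 ζ := by
  rw [covInvForm_eq_sum_dotProduct]
  have h : ∀ i, m2 * ∑ x, ζ x i ^ 2 ≤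
      (fun x => ζ x i) ⬝ᵥ (covInvMatrix d (α / 2) M m2 *ᵥ fun x => ζ x i) := fun i =>
    le_dotProduct_covInvMatrix_mulVec hd (by positivity) (by linarith) m2 fun x => ζ x i
  calc m2 * ∑ x, sqNorm (ζ x) = ∑ i, m2 * ∑ x, ζ x i ^ 2 := by
        unfold sqNorm
        rw [Finset.sum_comm, Finset.mul_sum]
    _ ≤ _ := Finset.sum_le_sum fun i _ => h i


/-! ### §2.2.3: periodisation of matrices on `ℓ^∞(ℤ^d)` and Lemma 2.2.2 -/

/-- **Periodisation of a matrix on `ℤ^d`** (Slade §2.2.2–§2.2.3): for `K = (K_{x',y'})` indexed by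
`ℤ^d` and the torus `Λ = ℤ^d/Mℤ^d`, `K̂_{x,y} = Σ_{y' ~ y} K_{x̃,y'} = Σ_{z∈ℤ^d} K_{x̃, ỹ+Mz}` with the
`ZMod.val` representatives `x̃, ỹ` ("on the right-hand side we choose representatives in `ℤ^d`
for `x, y ∈ Λ`"). The torus fractional Laplacian `fracLaplacianTorus` of the barrier file is
`periodise M (fracLaplacianZd d β)` by definition. [cite: Slade2017, §2.2.2 and Lemma 2.2.2 (T̂)] -/
def periodise (M : ℕ) (K : Site d → Site d → ℝ) (x y : TorusSite d M) : ℝ :=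
  ∑' z : Site d, K (fun j => ((x j).val : ℤ)) (fun j => ((y j).val : ℤ) + M * z j)

/-- `(-Δ_Λ)^β` is the periodisation of `(-Δ_{ℤ^d})^β` (definitionally).
[cite: Slade2017, §2.2.2 (torus fractional Laplacian)] -/
theorem fracLaplacianTorus_eq_periodise (β : ℝ) (M : ℕ) :
    fracLaplacianTorus d β M = periodise M (fracLaplacianZd d β) := rfl

/-- `x̃ = z̃ + Mw` for `ZMod.val` representatives forces `x = z` and `w = 0`. [folklore] -/
theorem rep_eq_rep_add_iff {M : ℕ} [NeZero M] (x z : TorusSite d M) (w : Site d) :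
    ((fun j => ((x j).val : ℤ)) = fun j => ((z j).val : ℤ) + M * w j) ↔ x = z ∧ w = 0 := by
  constructor
  · intro h
    have hxz : x = z := torus_eq_of_rep_eq h.symm
    subst hxz
    refine ⟨rfl, funext fun j => ?_⟩
    have hj := congr_fun h j
    have hM : (M : ℤ) ≠ 0 := by exact_mod_cast NeZero.ne M
    have : (M : ℤ) * w j = 0 := by linarith
    exact (mul_eq_zero.1 this).resolve_left hM
  · rintro ⟨rfl, rfl⟩
    funext j
    simp

/-- A translation-invariant matrix is determined by its row through the origin:
`K_{x,y} = K_{0,y-x}`. [folklore] -/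
theorem transInv_apply {K : Site d → Site d → ℝ} (hK : ∀ x y v, K (x + v) (y + v) = K x y)
    (x y : Site d) : K x y = K 0 (y - x) := by
  have h := hK 0 (y - x) x
  rwa [zero_add, sub_add_cancel] at h

/-- Rows of a translation-invariant matrix with one absolutely summable row are all absolutely
summable, with the same `ℓ¹` norm. [folklore] -/
theorem transInv_row_summable {K : Site d → Site d → ℝ} (hK : ∀ x y v, K (x + v) (y + v) = K x y)
    (h0 : Summable fun y => |K 0 y|) (x : Site d) :
    Summable (fun y => |K x y|) ∧ ∑' y, |K x y| = ∑' y, |K 0 y| := by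
  have he : (fun y => |K x y|) = (fun w => |K 0 w|) ∘ (Equiv.subRight x) := by
    funext y
    simp only [Function.comp_apply, Equiv.subRight_apply, transInv_apply hK x y]
  rw [he]
  exact ⟨(Equiv.subRight x).summable_iff.2 h0, (Equiv.subRight x).tsum_eq fun w => |K 0 w|⟩

/-- An entry is bounded by the `ℓ¹` norm of its row. [folklore] -/
theorem abs_le_tsum_row {K : Site d → Site d → ℝ} {x : Site d} (h : Summable fun y => |K x y|)
    (y : Site d) : |K x y| ≤ ∑' w, |K x w| :=
  le_hasSum h.hasSum y fun _ _ => abs_nonneg _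

/-- "On the right-hand side we choose representatives": the periodisation of a
translation-invariant matrix does not depend on the representatives.
[cite: Slade2017, §2.2.2 and Lemma 2.2.2] -/
theorem periodise_eq_tsum_of_rep {M : ℕ} [NeZero M] {K : Site d → Site d → ℝ}
    (hK : ∀ x y v, K (x + v) (y + v) = K x y) (x y : TorusSite d M) (r s : Site d)
    (hr : ∀ j, ((r j : ℤ) : ZMod M) = x j) (hs : ∀ j, ((s j : ℤ) : ZMod M) = y j) :
    periodise M K x y = ∑' z : Site d, K r (fun j => s j + M * z j) := by
  obtain ⟨p, hp⟩ := exists_rep_eq_val_add x r hr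
  obtain ⟨q, hq⟩ := exists_rep_eq_val_add y s hs
  unfold periodise
  rw [← (Equiv.addRight (q - p)).tsum_eq]
  refine tsum_congr fun z => ?_
  simp only [Equiv.coe_addRight]
  have e1 : (fun j => s j + (M : ℤ) * z j) =
      (fun j => ((y j).val : ℤ) + (M : ℤ) * (z + (q - p)) j) + fun j => (M : ℤ) * p j := by
    funext j
    simp only [Pi.add_apply, Pi.sub_apply, hq j]
    ring
  have e2 : r = (fun j => ((x j).val : ℤ)) + fun j => (M : ℤ) * p j := by
    funext j
    simp only [Pi.add_apply, hp j]
  rw [e1, e2, hK]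

/-- The periodisation sum converges as soon as the row is summable.
[cite: Slade2017, §2.2.2 ("Summability of the right-hand side")] -/
theorem hasSum_periodise {M : ℕ} [NeZero M] (K : Site d → Site d → ℝ) (x y : TorusSite d M)
    (hrow : Summable fun w => K (fun j => ((x j).val : ℤ)) w) :
    HasSum (fun z : Site d => K (fun j => ((x j).val : ℤ)) (fun j => ((y j).val : ℤ) + M * z j))
      (periodise M K x y) := by
  have hinj : Function.Injective
      fun z : Site d => (fun j => ((y j).val : ℤ) + M * z j : Site d) := by
    intro z₁ z₂ h
    funext j
    have hj := congr_fun h j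
    simpa [NeZero.ne M] using hj
  unfold periodise
  exact (hrow.comp_injective hinj).hasSum

/-- The periodisation of the identity matrix of `ℤ^d` is the identity matrix of the torus.
[cite: Slade2017, Lemma 2.2.2 (proof, last equality)] -/
theorem periodise_delta {M : ℕ} [NeZero M] (x y : TorusSite d M) :
    periodise M (fun a b : Site d => if a = b then (1 : ℝ) else 0) x y = if x = y then 1 else 0 := by
  unfold periodise
  rw [tsum_eq_single 0]
  · dsimp only
    by_cases hxy : x = y
    · subst hxy
      simp
    · rw [if_neg hxy, if_neg]
      intro h
      exact hxy ((rep_eq_rep_add_iff x y 0).1 h).1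
  · intro w hw
    dsimp only
    rw [if_neg]
    intro h
    exact hw ((rep_eq_rep_add_iff x y w).1 h).2

/-- Periodisation is additive (rows summable). [folklore] -/
theorem periodise_add {M : ℕ} [NeZero M] (K₁ K₂ : Site d → Site d → ℝ) (x y : TorusSite d M)
    (h₁ : Summable fun w => K₁ (fun j => ((x j).val : ℤ)) w)
    (h₂ : Summable fun w => K₂ (fun j => ((x j).val : ℤ)) w) :
    periodise M (fun a b => K₁ a b + K₂ a b) x y = periodise M K₁ x y + periodise M K₂ x y :=
  ((hasSum_periodise K₁ x y h₁).add (hasSum_periodise K₂ x y h₂)).tsum_eq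

/-- Periodisation is homogeneous. [folklore] -/
theorem periodise_const_mul {M : ℕ} [NeZero M] (c : ℝ) (K : Site d → Site d → ℝ)
    (x y : TorusSite d M) : periodise M (fun a b => c * K a b) x y = c * periodise M K x y := by
  unfold periodise
  rw [tsum_mul_left]

/-- **Uniqueness of the bounded inverse: the inverse of a translation-invariant matrix is
translation invariant** ("The assumed translation invariance for `T` implies the same for
`T⁻¹`", proof of Lemma 2.2.2): if `T` is translation invariant with absolutely summable rows,
`S` has uniformly absolutely summable rows (`S : ℓ^∞ → ℓ^∞`), and `TS = ST = I`, then
`S_{x+v,z+v} = S_{x,z}`. [cite: Slade2017, Lemma 2.2.2 (proof, first sentence)] -/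
theorem inverse_transInv {T S : Site d → Site d → ℝ}
    (hT : ∀ x y v, T (x + v) (y + v) = T x y) (hTrow : Summable fun y => |T 0 y|)
    (hSrow : ∀ x, Summable fun y => |S x y|) {B : ℝ} (hSB : ∀ x, ∑' y, |S x y| ≤ B)
    (hTS : ∀ x z, HasSum (fun y => T x y * S y z) (if x = z then 1 else 0))
    (hST : ∀ x z, HasSum (fun y => S x y * T y z) (if x = z then 1 else 0)) (x z v : Site d) :
    S (x + v) (z + v) = S x z := by
  set S' : Site d → Site d → ℝ := fun a b => S (a + v) (b + v) with hS'
  have hB0 : 0 ≤ B := le_trans (tsum_nonneg fun y => abs_nonneg (S 0 y)) (hSB 0)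
  -- `T S' = I`
  have hTS' : ∀ a b, HasSum (fun y => T a y * S' y b) (if a = b then 1 else 0) := by
    intro a b
    have h := hTS (a + v) (b + v)
    have key : (if a + v = b + v then (1 : ℝ) else 0) = if a = b then 1 else 0 := by
      by_cases hab : a = b
      · subst hab; simp
      · rw [if_neg hab, if_neg fun h' => hab (add_right_cancel h')]
    rw [key] at h
    have h2 := ((Equiv.addRight v).hasSum_iff (f := fun y => T (a + v) y * S y (b + v))).2 h
    refine h2.congr_fun ?_
    intro y
    simp only [hS', Function.comp_apply, Equiv.coe_addRight, hT]
  -- the double family `(y, w) ↦ S x y T y w S' w z`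
  set g : Site d → Site d → ℝ := fun y w => S x y * T y w * S' w z with hg
  have hS'bd : ∀ w, |S' w z| ≤ B := fun w =>
    (abs_le_tsum_row (hSrow (w + v)) (z + v)).trans (hSB (w + v))
  have hTrow' : ∀ y, Summable (fun w => |T y w|) ∧ ∑' w, |T y w| = ∑' w, |T 0 w| :=
    fun y => transInv_row_summable hT hTrow y
  -- rows of `g`
  have hrow : ∀ y, HasSum (g y) (S x y * if y = z then 1 else 0) := by
    intro y
    have h := (hTS' y z).mul_left (S x y)
    refine h.congr_fun fun w => ?_
    simp only [hg]
    ring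
  have hrowtot : HasSum (fun y => S x y * if y = z then (1 : ℝ) else 0) (S x z) := by
    have : (fun y => S x y * if y = z then (1 : ℝ) else 0) = fun y => if y = z then S x z else 0 := by
      funext y
      split_ifs with h
      · subst h; ring
      · ring
    rw [this]
    exact hasSum_ite_eq z (S x z)
  -- domination
  set f : Site d → Site d → ℝ := fun y w => |S x y| * (|T y w| * B) with hf
  have hfg : ∀ y w, |g y w| ≤ f y w := by
    intro y w
    simp only [hg, hf, abs_mul]
    have h1 : |S' w z| ≤ B := hS'bd w
    have : |S x y| * |T y w| * |S' w z| ≤ |S x y| * |T y w| * B :=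
      mul_le_mul_of_nonneg_left h1 (by positivity)
    linarith
  have hfrow : ∀ y, HasSum (f y) (|S x y| * ((∑' w, |T 0 w|) * B)) := by
    intro y
    simp only [hf]
    rw [← (hTrow' y).2]
    exact (((hTrow' y).1.hasSum).mul_right B).mul_left _
  have hftot : HasSum (fun y => |S x y| * ((∑' w, |T 0 w|) * B))
      ((∑' y, |S x y|) * ((∑' w, |T 0 w|) * B)) := (hSrow x).hasSum.mul_right _
  obtain ⟨-, hswap⟩ := hasSum_swap_of_abs_le hfg hfrow hftot hrow hrowtot
  -- columns of `g`
  have hcol : ∀ w, ∑' y, g y w = (if x = w then 1 else 0) * S' w z := by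
    intro w
    simp only [hg]
    rw [tsum_mul_right, (hST x w).tsum_eq]
  simp_rw [hcol] at hswap
  have hS'sum : HasSum (fun w => (if x = w then (1 : ℝ) else 0) * S' w z) (S' x z) := by
    have : (fun w => (if x = w then (1 : ℝ) else 0) * S' w z) = fun w => if w = x then S' x z else 0 := by
      funext w
      by_cases h : w = x
      · subst h; simp
      · rw [if_neg h, if_neg (Ne.symm h), zero_mul]
    rw [this]
    exact hasSum_ite_eq x (S' x z)
  have := hswap.unique hS'sum
  simp only [hS'] at this
  exact this.symm

/-- **Slade, Lemma 2.2.2, PROVED** (torus inverses by periodisation). Let `T = (T_{x',y'})` be a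
matrix indexed by `ℤ^d` acting on `ℓ^∞(ℤ^d)` (absolutely summable rows), translation invariant
(`T_{x'+z',y'+z'} = T_{x',y'}`), with inverse matrix `T⁻¹ : ℓ^∞(ℤ^d) → ℓ^∞(ℤ^d)` (uniformly
absolutely summable rows, `TT⁻¹ = T⁻¹T = I`). Then the periodisations `T̂_{x,y} = Σ_{y'~y} T_{x̃,y'}`
and `Σ_{y'~y} T⁻¹_{x̃,y'}` on the torus `ℤ^d/Mℤ^d` are inverse matrices. Printed proof: translation
invariance of `T⁻¹` (`inverse_transInv`), then `Σ_{y∈Λ} T̂_{x,y} Ŝ_{y,z} = Σ_{y∈Λ} Σ_{y'~y} T_{x̃,y'}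
Σ_{z''~z} T⁻¹_{y',z''} = Σ_{z''~z} δ_{x̃,z''} = δ_{x,z}`; here with the absolute convergence that
justifies the rearrangements made explicit. [cite: Slade2017, Lemma 2.2.2] -/
theorem Slade2017_lem222 {M : ℕ} [NeZero M] (T S : Site d → Site d → ℝ)
    (hT : ∀ x y v, T (x + v) (y + v) = T x y) (hTrow : Summable fun y => |T 0 y|)
    (hSrow : ∀ x, Summable fun y => |S x y|) {B : ℝ} (hSB : ∀ x, ∑' y, |S x y| ≤ B)
    (hTS : ∀ x z, HasSum (fun y => T x y * S y z) (if x = z then 1 else 0))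
    (hST : ∀ x z, HasSum (fun y => S x y * T y z) (if x = z then 1 else 0)) :
    Matrix.of (periodise M T) * Matrix.of (periodise M S) = 1 ∧
      Matrix.of (periodise M S) * Matrix.of (periodise M T) = 1 := by
  have hS : ∀ x y v, S (x + v) (y + v) = S x y := fun x y v =>
    inverse_transInv hT hTrow hSrow hSB hTS hST x y v
  have hTrow' : ∀ y, Summable (fun w => |T y w|) ∧ ∑' w, |T y w| = ∑' w, |T 0 w| :=
    fun y => transInv_row_summable hT hTrow y
  have hmul : Matrix.of (periodise M T) * Matrix.of (periodise M S) = 1 := by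
    ext x z
    simp only [Matrix.mul_apply, Matrix.of_apply, Matrix.one_apply]
    set xr : Site d := fun j => ((x j).val : ℤ) with hxr
    set zr : Site d := fun j => ((z j).val : ℤ) with hzr
    -- the periodised column sums of `S`
    set PS : Site d → ℝ := fun y' => ∑' w : Site d, S y' (fun j => zr j + M * w j) with hPS
    have hinj : Function.Injective fun w : Site d => (fun j => zr j + M * w j : Site d) := by
      intro w₁ w₂ h
      funext j
      have hj := congr_fun h j
      simpa [NeZero.ne M] using hj
    have hPSsum : ∀ y', HasSum (fun w : Site d => S y' (fun j => zr j + M * w j)) (PS y') :=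
      fun y' => ((hSrow y').of_abs.comp_injective hinj).hasSum
    have hPSabs : ∀ y', HasSum (fun w : Site d => |S y' (fun j => zr j + M * w j)|)
        (∑' w : Site d, |S y' (fun j => zr j + M * w j)|) :=
      fun y' => ((hSrow y').comp_injective hinj).hasSum
    have hPSle : ∀ y', ∑' w : Site d, |S y' (fun j => zr j + M * w j)| ≤ B := fun y' =>
      (tsum_comp_le_tsum_of_inj (hSrow y') (fun w => abs_nonneg _) hinj).trans (hSB y')
    have hB0 : 0 ≤ B := le_trans (tsum_nonneg fun y => abs_nonneg (S 0 y)) (hSB 0)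
    have hPSbd : ∀ y', |PS y'| ≤ B := by
      intro y'
      have hn : Summable fun w : Site d => ‖S y' (fun j => zr j + M * w j)‖ := by
        have h1 : Summable fun w : Site d => |S y' (fun j => zr j + M * w j)| :=
          (hSrow y').comp_injective hinj
        exact h1.congr fun w => (Real.norm_eq_abs _).symm
      have h := norm_tsum_le_tsum_norm hn
      simp only [Real.norm_eq_abs] at h
      exact h.trans (hPSle y')
    -- `PS` is constant on residue classes: `PS (ỹ + Mw') = Ŝ_{y,z}`
    have hPSper : ∀ (y : TorusSite d M) (w' : Site d),
        PS (fun j => ((y j).val : ℤ) + M * w' j) = periodise M S y z := by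
      intro y w'
      simp only [hPS]
      rw [periodise_eq_tsum_of_rep hS y z (fun j => ((y j).val : ℤ) + M * w' j) zr
        (fun j => by simp) (fun j => by simp [hzr])]
    -- the double family
    set g : Site d → Site d → ℝ := fun y' w => T xr y' * S y' (fun j => zr j + M * w j) with hg
    have hgrow : ∀ y', HasSum (g y') (T xr y' * PS y') := fun y' => (hPSsum y').mul_left _
    set f : Site d → Site d → ℝ := fun y' w => |T xr y'| * |S y' (fun j => zr j + M * w j)|
      with hf
    have hfg : ∀ y' w, |g y' w| ≤ f y' w := fun y' w => by
      simp only [hg, hf, abs_mul]; exact le_rfl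
    have hfrow : ∀ y', HasSum (f y') (|T xr y'| * ∑' w : Site d, |S y' (fun j => zr j + M * w j)|) :=
      fun y' => (hPSabs y').mul_left _
    have hftot : Summable fun y' => |T xr y'| * ∑' w : Site d, |S y' (fun j => zr j + M * w j)| := by
      refine Summable.of_nonneg_of_le (fun y' => by positivity) (fun y' => ?_)
        ((hTrow' xr).1.mul_right B)
      exact mul_le_mul_of_nonneg_left (hPSle y') (abs_nonneg _)
    -- total of the rows: regroup `ℤ^d = ⊔_y (ỹ + Mℤ^d)`
    have hbsum : Summable fun y' => T xr y' * PS y' := by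
      refine Summable.of_norm_bounded ((hTrow' xr).1.mul_right B) fun y' => ?_
      rw [Real.norm_eq_abs, abs_mul]
      exact mul_le_mul_of_nonneg_left (hPSbd y') (abs_nonneg _)
    have hbtot : HasSum (fun y' => T xr y' * PS y')
        (∑ y, periodise M T x y * periodise M S y z) := by
      set e := torusProdSiteEquiv d M with he
      have h1 : HasSum ((fun y' => T xr y' * PS y') ∘ e) (∑' y', T xr y' * PS y') :=
        (e.hasSum_iff).2 hbsum.hasSum
      have h2 : ∀ y : TorusSite d M, HasSum (fun w' : Site d => ((fun y' => T xr y' * PS y') ∘ e) (y, w'))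
          (periodise M T x y * periodise M S y z) := by
        intro y
        have h3 : (fun w' : Site d => ((fun y' => T xr y' * PS y') ∘ e) (y, w')) =
            fun w' => T xr (fun j => ((y j).val : ℤ) + M * w' j) * periodise M S y z := by
          funext w'
          simp only [Function.comp_apply, he, torusProdSiteEquiv_apply, hPSper]
        rw [h3]
        exact (hasSum_periodise T x y (hTrow' xr).1.of_abs).mul_right _
      have h4 := h1.prod_fiberwise h2
      have h5 := (hasSum_fintype fun y => periodise M T x y * periodise M S y z).unique h4
      rw [h5]
      exact hbsum.hasSum
    obtain ⟨-, hswap⟩ := hasSum_swap_of_abs_le hfg hfrow hftot.hasSum hgrow hbtot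
    -- columns: `Σ_{y'} T_{x̃,y'} S_{y', z̃+Mw} = δ_{x̃, z̃+Mw}`
    have hcol : ∀ w, ∑' y', g y' w = if xr = (fun j => zr j + M * w j) then 1 else 0 := fun w =>
      (hTS xr _).tsum_eq
    simp_rw [hcol] at hswap
    have hdelta : HasSum (fun w : Site d => if xr = (fun j => zr j + M * w j) then (1 : ℝ) else 0)
        (if x = z then 1 else 0) := by
      have : (fun w : Site d => if xr = (fun j => zr j + M * w j) then (1 : ℝ) else 0) =
          fun w => if w = 0 then (if x = z then 1 else 0) else 0 := by
        funext w
        simp only [hxr, hzr, rep_eq_rep_add_iff x z w]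
        by_cases hw : w = 0
        · subst hw; simp
        · simp [hw]
      rw [this]
      exact hasSum_ite_eq 0 _
    exact hswap.unique hdelta
  exact ⟨hmul, mul_eq_one_comm.1 hmul⟩


/-! ### §2.1.2/§2.2.1: the `ℤ^d` resolvent `((-Δ)^β + m²)⁻¹` by the Neumann series of the jump chain -/

/-- The jump kernel of the long-range walk generated by `-(-Δ)^β` (Lemma 2.2.1):
`P_{x,y} = -((-Δ)^β)_{x,y}/κ` for `y ≠ x`, `P_{x,x} = 0`, with `κ = ((-Δ)^β)_{0,0}` — so that
`(-Δ)^β = κ(I - P)` with `P` a symmetric stochastic matrix. [cite: Slade2017, Lemma 2.2.1 and §2.2.1] -/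
def jumpKernel (d : ℕ) (β : ℝ) (x y : Site d) : ℝ :=
  if x = y then 0 else -fracLaplacianZd d β x y / fracLaplacianZd d β 0 0

/-- The `n`-step kernels `Pⁿ` of the jump chain: `P⁰ = I`, `Pⁿ⁺¹_{x,y} = Σ_w P_{x,w} Pⁿ_{w,y}`.
[cite: Slade2017, §2.2.1] -/
def jumpKernelPow (d : ℕ) (β : ℝ) : ℕ → Site d → Site d → ℝ
  | 0 => fun x y => if x = y then 1 else 0
  | n + 1 => fun x y => ∑' w : Site d, jumpKernel d β x w * jumpKernelPow d β n w y

/-- **The resolvent `((-Δ)^β + m²)⁻¹` on `ℤ^d`** (§2.1.2), constructed for `m² > 0` by the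
Neumann series of the jump chain: with `(-Δ)^β = κ(I - P)`,
`((-Δ)^β + m²)⁻¹ = (κ + m²)⁻¹ Σ_{n≥0} (κ/(κ+m²))ⁿ Pⁿ` (entrywise absolutely convergent). That this
is THE inverse matrix `ℓ^∞(ℤ^d) → ℓ^∞(ℤ^d)` of `(-Δ)^β + m²` is `hasSum_fracLaplacianZd_mul_resolvent`
/ `hasSum_resolvent_mul_fracLaplacianZd` below (uniqueness: `inverse_transInv`).
[cite: Slade2017, §2.1.2 (resolvent of the fractional Laplacian) and §2.2.3] -/
def fracResolventZd (d : ℕ) (β m2 : ℝ) (x y : Site d) : ℝ :=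
  (fracLaplacianZd d β 0 0 + m2)⁻¹ *
    ∑' n : ℕ, (fracLaplacianZd d β 0 0 / (fracLaplacianZd d β 0 0 + m2)) ^ n *
      jumpKernelPow d β n x y

section Resolvent

variable (hd : 1 ≤ d) {β : ℝ} (hβ0 : 0 < β) (hβ1 : β < 1)
include hd hβ0 hβ1

/-- `κ = ((-Δ)^β)_{0,0} > 0`. [cite: Slade2017, Lemma 2.2.1] -/
theorem fracLapDiag_pos : 0 < fracLaplacianZd d β 0 0 := fracLaplacianZd_self_pos hd hβ0 hβ1 0

omit hd hβ0 hβ1 in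
/-- `((-Δ)^β)_{x,x} = κ`. [cite: Slade2017, §2.1.1 (translation invariance)] -/
theorem fracLaplacianZd_self_eq (β : ℝ) (x : Site d) :
    fracLaplacianZd d β x x = fracLaplacianZd d β 0 0 := by
  have h := fracLaplacianZd_add d β 0 0 x
  rwa [zero_add] at h

/-- `P ≥ 0`. [cite: Slade2017, Lemma 2.2.1] -/
theorem jumpKernel_nonneg (x y : Site d) : 0 ≤ jumpKernel d β x y := by
  unfold jumpKernel
  split_ifs with h
  · exact le_rfl
  · have h1 := fracLaplacianZd_neg hd hβ0 hβ1 (Ne.symm h)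
    have h2 := fracLapDiag_pos hd hβ0 hβ1
    exact div_nonneg (by linarith) h2.le

/-- `P_{x,y} > 0` for `x ≠ y` (the chain jumps everywhere). [cite: Slade2017, Lemma 2.2.1] -/
theorem jumpKernel_pos {x y : Site d} (hxy : x ≠ y) : 0 < jumpKernel d β x y := by
  unfold jumpKernel
  rw [if_neg hxy]
  have h1 := fracLaplacianZd_neg hd hβ0 hβ1 (Ne.symm hxy)
  exact div_pos (by linarith) (fracLapDiag_pos hd hβ0 hβ1)

omit hd hβ0 hβ1 in
/-- `P` is symmetric. [cite: Slade2017, Lemma 2.2.1] -/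
theorem jumpKernel_comm (β : ℝ) (x y : Site d) : jumpKernel d β x y = jumpKernel d β y x := by
  unfold jumpKernel
  rw [fracLaplacianZd_comm d β x y]
  by_cases h : x = y
  · subst h; rfl
  · rw [if_neg h, if_neg (Ne.symm h)]

omit hd hβ0 hβ1 in
/-- `P` is translation invariant. [cite: Slade2017, §2.1.1] -/
theorem jumpKernel_add (β : ℝ) (x y v : Site d) :
    jumpKernel d β (x + v) (y + v) = jumpKernel d β x y := by
  unfold jumpKernel
  rw [fracLaplacianZd_add]
  by_cases h : x = y
  · subst h; simp
  · rw [if_neg h, if_neg fun h' => h (add_right_cancel h')]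

/-- **`(-Δ)^β = κ(I - P)`** entrywise. [cite: Slade2017, Lemma 2.2.1 and §2.2.1] -/
theorem fracLaplacianZd_eq_kappa (x y : Site d) :
    fracLaplacianZd d β x y =
      fracLaplacianZd d β 0 0 * ((if x = y then 1 else 0) - jumpKernel d β x y) := by
  have hκ := (fracLapDiag_pos hd hβ0 hβ1).ne'
  unfold jumpKernel
  by_cases h : x = y
  · subst h
    rw [if_pos rfl, if_pos rfl, fracLaplacianZd_self_eq]
    ring
  · rw [if_neg h, if_neg h]
    field_simp
    ring

/-- **`P` is stochastic**: `Σ_y P_{x,y} = 1` (row sums of `(-Δ)^β` vanish, Lemma 2.2.1).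
[cite: Slade2017, Lemma 2.2.1] -/
theorem hasSum_jumpKernel (x : Site d) : HasSum (fun y => jumpKernel d β x y) 1 := by
  have hκ := (fracLapDiag_pos hd hβ0 hβ1).ne'
  have hrow := hasSum_fracLaplacianZd_row hd hβ0 hβ1 x
  have h1 : HasSum (fun y : Site d => (if x = y then (1 : ℝ) else 0)) 1 := by
    have : (fun y : Site d => (if x = y then (1 : ℝ) else 0)) = fun y => if y = x then 1 else 0 := by
      funext y
      by_cases h : y = x
      · subst h; simp
      · rw [if_neg h, if_neg (Ne.symm h)]
    rw [this]
    exact hasSum_ite_eq x 1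
  have h2 := h1.sub (hrow.div_const (fracLaplacianZd d β 0 0))
  rw [zero_div, sub_zero] at h2
  refine h2.congr_fun fun y => ?_
  rw [fracLaplacianZd_eq_kappa hd hβ0 hβ1 x y]
  field_simp
  ring

/-- Rows of `P` are summable. [cite: Slade2017, Lemma 2.2.1] -/
theorem summable_jumpKernel (x : Site d) : Summable fun y => jumpKernel d β x y :=
  (hasSum_jumpKernel hd hβ0 hβ1 x).summable

/-- **The `n`-step kernels are substochastic probability kernels**: `Pⁿ ≥ 0`, `Σ_y Pⁿ_{x,y} = 1`,
and the defining series `Σ_w P_{x,w}Pⁿ_{w,y}` converges (to `Pⁿ⁺¹_{x,y}`). [cite: Slade2017, §2.2.1] -/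
theorem jumpKernelPow_spec (n : ℕ) :
    (∀ x y, 0 ≤ jumpKernelPow d β n x y) ∧ (∀ x, HasSum (fun y => jumpKernelPow d β n x y) 1) := by
  induction n with
  | zero =>
    refine ⟨fun x y => ?_, fun x => ?_⟩
    · simp only [jumpKernelPow]
      split_ifs <;> norm_num
    · simp only [jumpKernelPow]
      have : (fun y : Site d => (if x = y then (1 : ℝ) else 0)) = fun y => if y = x then 1 else 0 := by
        funext y
        by_cases h : y = x
        · subst h; simp
        · rw [if_neg h, if_neg (Ne.symm h)]
      rw [this]
      exact hasSum_ite_eq x 1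
  | succ n ih =>
    obtain ⟨hnn, hsum⟩ := ih
    have hswap : ∀ x, (∀ y, Summable fun w => jumpKernel d β x w * jumpKernelPow d β n w y) ∧
        HasSum (fun y => ∑' w, jumpKernel d β x w * jumpKernelPow d β n w y) 1 := by
      intro x
      have h := hasSum_swap_of_nonneg (f := fun w y => jumpKernel d β x w * jumpKernelPow d β n w y)
        (fun w y => mul_nonneg (jumpKernel_nonneg hd hβ0 hβ1 x w) (hnn w y))
        (fun w => (hsum w).mul_left (jumpKernel d β x w)) (s := 1) ?_
      · exact h
      · simpa only [mul_one] using hasSum_jumpKernel hd hβ0 hβ1 x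
    refine ⟨fun x y => ?_, fun x => ?_⟩
    · simp only [jumpKernelPow]
      exact tsum_nonneg fun w => mul_nonneg (jumpKernel_nonneg hd hβ0 hβ1 x w) (hnn w y)
    · simp only [jumpKernelPow]
      exact (hswap x).2

/-- `Pⁿ ≥ 0`. [cite: Slade2017, §2.2.1] -/
theorem jumpKernelPow_nonneg (n : ℕ) (x y : Site d) : 0 ≤ jumpKernelPow d β n x y :=
  (jumpKernelPow_spec hd hβ0 hβ1 n).1 x y

/-- `Σ_y Pⁿ_{x,y} = 1`. [cite: Slade2017, §2.2.1] -/
theorem hasSum_jumpKernelPow (n : ℕ) (x : Site d) :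
    HasSum (fun y => jumpKernelPow d β n x y) 1 :=
  (jumpKernelPow_spec hd hβ0 hβ1 n).2 x

/-- `Pⁿ ≤ 1`. [cite: Slade2017, §2.2.1] -/
theorem jumpKernelPow_le_one (n : ℕ) (x y : Site d) : jumpKernelPow d β n x y ≤ 1 :=
  le_hasSum (hasSum_jumpKernelPow hd hβ0 hβ1 n x) y fun w _ => jumpKernelPow_nonneg hd hβ0 hβ1 n x w

/-- The defining series of `Pⁿ⁺¹ = P Pⁿ` converges. [cite: Slade2017, §2.2.1] -/
theorem hasSum_jumpKernelPow_succ (n : ℕ) (x y : Site d) :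
    HasSum (fun w => jumpKernel d β x w * jumpKernelPow d β n w y) (jumpKernelPow d β (n + 1) x y) := by
  have hs : Summable fun w => jumpKernel d β x w * jumpKernelPow d β n w y := by
    refine Summable.of_nonneg_of_le
      (fun w => mul_nonneg (jumpKernel_nonneg hd hβ0 hβ1 x w) (jumpKernelPow_nonneg hd hβ0 hβ1 n w y))
      (fun w => ?_) (summable_jumpKernel hd hβ0 hβ1 x)
    have := mul_le_mul_of_nonneg_left (jumpKernelPow_le_one hd hβ0 hβ1 n w y)
      (jumpKernel_nonneg hd hβ0 hβ1 x w)
    simpa using this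
  simp only [jumpKernelPow]
  exact hs.hasSum

/-- **`Pⁿ⁺¹ = Pⁿ P`** as well (the two recursions agree): `Σ_u Pⁿ_{x,u} P_{u,y} = Pⁿ⁺¹_{x,y}`,
by induction with one Fubini interchange per step. [folklore] -/
theorem hasSum_jumpKernelPow_succ_right (n : ℕ) :
    ∀ x y : Site d, HasSum (fun u => jumpKernelPow d β n x u * jumpKernel d β u y)
      (jumpKernelPow d β (n + 1) x y) := by
  induction n with
  | zero =>
    intro x y
    -- `P¹ = P`
    have h1 : jumpKernelPow d β 1 x y = jumpKernel d β x y := by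
      have h := hasSum_jumpKernelPow_succ hd hβ0 hβ1 0 x y
      have h' : HasSum (fun w => jumpKernel d β x w * jumpKernelPow d β 0 w y) (jumpKernel d β x y) := by
        have : (fun w => jumpKernel d β x w * jumpKernelPow d β 0 w y) =
            fun w => if w = y then jumpKernel d β x y else 0 := by
          funext w
          simp only [jumpKernelPow]
          by_cases hw : w = y
          · subst hw; simp
          · rw [if_neg hw, if_neg hw, mul_zero]
        rw [this]
        exact hasSum_ite_eq y _
      exact h.unique h'
    rw [h1]
    have : (fun u => jumpKernelPow d β 0 x u * jumpKernel d β u y) =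
        fun u => if u = x then jumpKernel d β x y else 0 := by
      funext u
      simp only [jumpKernelPow]
      by_cases hu : u = x
      · subst hu; simp
      · rw [if_neg hu, if_neg (Ne.symm hu), zero_mul]
    rw [this]
    exact hasSum_ite_eq x _
  | succ n ih =>
    intro x y
    -- double family `(w, u) ↦ P_{x,w} Pⁿ_{w,u} P_{u,y}`
    have h := hasSum_swap_of_nonneg
      (f := fun w u => jumpKernel d β x w * jumpKernelPow d β n w u * jumpKernel d β u y)
      (fun w u => mul_nonneg (mul_nonneg (jumpKernel_nonneg hd hβ0 hβ1 x w)
        (jumpKernelPow_nonneg hd hβ0 hβ1 n w u)) (jumpKernel_nonneg hd hβ0 hβ1 u y))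
      (a := fun w => jumpKernel d β x w * jumpKernelPow d β (n + 1) w y) (fun w => ?_)
      (hasSum_jumpKernelPow_succ hd hβ0 hβ1 (n + 1) x y)
    · obtain ⟨-, h2⟩ := h
      refine h2.congr_fun fun u => ?_
      rw [tsum_mul_right, (hasSum_jumpKernelPow_succ hd hβ0 hβ1 n x u).tsum_eq]
    · have := (ih w y).mul_left (jumpKernel d β x w)
      refine this.congr_fun fun u => ?_
      ring

/-- `Pⁿ` is symmetric. [folklore] -/
theorem jumpKernelPow_comm (n : ℕ) : ∀ x y : Site d, jumpKernelPow d β n x y = jumpKernelPow d β n y x := by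
  induction n with
  | zero =>
    intro x y
    simp only [jumpKernelPow]
    by_cases h : x = y
    · subst h; rfl
    · rw [if_neg h, if_neg (Ne.symm h)]
  | succ n ih =>
    intro x y
    have h1 := hasSum_jumpKernelPow_succ hd hβ0 hβ1 n x y
    have h2 := hasSum_jumpKernelPow_succ_right hd hβ0 hβ1 n y x
    refine h1.unique (h2.congr_fun fun w => ?_)
    rw [ih w y, jumpKernel_comm β x w, mul_comm]

/-- `Pⁿ` is translation invariant. [folklore] -/
theorem jumpKernelPow_add (n : ℕ) : ∀ x y v : Site d,
    jumpKernelPow d β n (x + v) (y + v) = jumpKernelPow d β n x y := by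
  induction n with
  | zero =>
    intro x y v
    simp only [jumpKernelPow]
    by_cases h : x = y
    · subst h; simp
    · rw [if_neg h, if_neg fun h' => h (add_right_cancel h')]
  | succ n ih =>
    intro x y v
    have h1 := hasSum_jumpKernelPow_succ hd hβ0 hβ1 n (x + v) (y + v)
    have h2 := hasSum_jumpKernelPow_succ hd hβ0 hβ1 n x y
    have h3 := ((Equiv.addRight v).hasSum_iff
      (f := fun w => jumpKernel d β (x + v) w * jumpKernelPow d β n w (y + v))).2 h1
    have h4 : HasSum (fun w => jumpKernel d β x w * jumpKernelPow d β n w y)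
        (jumpKernelPow d β (n + 1) (x + v) (y + v)) := by
      refine h3.congr_fun fun w => ?_
      simp only [Function.comp_apply, Equiv.coe_addRight, jumpKernel_add, ih]
    exact h4.unique h2

/-- The ratio `r = κ/(κ + m²) ∈ [0,1)` of the Neumann series (`m² > 0`). [folklore] -/
theorem resolventRatio_lt_one {m2 : ℝ} (hm2 : 0 < m2) :
    0 ≤ fracLaplacianZd d β 0 0 / (fracLaplacianZd d β 0 0 + m2) ∧
      fracLaplacianZd d β 0 0 / (fracLaplacianZd d β 0 0 + m2) < 1 := by
  have hκ := fracLapDiag_pos hd hβ0 hβ1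
  refine ⟨div_nonneg hκ.le (by linarith), ?_⟩
  rw [div_lt_one (by linarith)]
  linarith

/-- The Neumann series `Σ_n rⁿ Pⁿ_{x,y}` converges (dominated by the geometric series).
[cite: Slade2017, §2.1.2] -/
theorem summable_resolvent_series {m2 : ℝ} (hm2 : 0 < m2) (x y : Site d) :
    Summable fun n : ℕ => (fracLaplacianZd d β 0 0 / (fracLaplacianZd d β 0 0 + m2)) ^ n *
      jumpKernelPow d β n x y := by
  obtain ⟨hr0, hr1⟩ := resolventRatio_lt_one hd hβ0 hβ1 hm2
  refine Summable.of_nonneg_of_le (fun n => mul_nonneg (pow_nonneg hr0 n)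
    (jumpKernelPow_nonneg hd hβ0 hβ1 n x y)) (fun n => ?_) (summable_geometric_of_lt_one hr0 hr1)
  have := mul_le_mul_of_nonneg_left (jumpKernelPow_le_one hd hβ0 hβ1 n x y) (pow_nonneg hr0 n)
  simpa using this

/-- The defining series of the resolvent, as a `HasSum`. [cite: Slade2017, §2.1.2] -/
theorem hasSum_fracResolventZd {m2 : ℝ} (hm2 : 0 < m2) (x y : Site d) :
    HasSum (fun n : ℕ => (fracLaplacianZd d β 0 0 + m2)⁻¹ *
      ((fracLaplacianZd d β 0 0 / (fracLaplacianZd d β 0 0 + m2)) ^ n * jumpKernelPow d β n x y))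
      (fracResolventZd d β m2 x y) := by
  unfold fracResolventZd
  exact (summable_resolvent_series hd hβ0 hβ1 hm2 x y).hasSum.mul_left _

/-- `((-Δ)^β + m²)⁻¹_{x,y} ≥ 0`. [cite: Slade2017, §2.1.2] -/
theorem fracResolventZd_nonneg {m2 : ℝ} (hm2 : 0 < m2) (x y : Site d) :
    0 ≤ fracResolventZd d β m2 x y := by
  have hκ := fracLapDiag_pos hd hβ0 hβ1
  obtain ⟨hr0, -⟩ := resolventRatio_lt_one hd hβ0 hβ1 hm2
  unfold fracResolventZd
  exact mul_nonneg (inv_nonneg.2 (by linarith)) (tsum_nonneg fun n =>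
    mul_nonneg (pow_nonneg hr0 n) (jumpKernelPow_nonneg hd hβ0 hβ1 n x y))

/-- **`((-Δ)^β + m²)⁻¹_{x,y} > 0` for all `x, y`** (the terms `n = 0` resp. `n = 1` of the
Neumann series are positive on resp. off the diagonal). [cite: Slade2017, §2.1.2] -/
theorem fracResolventZd_pos {m2 : ℝ} (hm2 : 0 < m2) (x y : Site d) :
    0 < fracResolventZd d β m2 x y := by
  have hκ := fracLapDiag_pos hd hβ0 hβ1
  obtain ⟨hr0, -⟩ := resolventRatio_lt_one hd hβ0 hβ1 hm2
  have hrpos : 0 < fracLaplacianZd d β 0 0 / (fracLaplacianZd d β 0 0 + m2) :=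
    div_pos hκ (by linarith)
  have hc : 0 < (fracLaplacianZd d β 0 0 + m2)⁻¹ := inv_pos.2 (by linarith)
  have h := hasSum_fracResolventZd hd hβ0 hβ1 hm2 x y
  have hnn : ∀ n, 0 ≤ (fracLaplacianZd d β 0 0 + m2)⁻¹ *
      ((fracLaplacianZd d β 0 0 / (fracLaplacianZd d β 0 0 + m2)) ^ n * jumpKernelPow d β n x y) :=
    fun n => mul_nonneg hc.le (mul_nonneg (pow_nonneg hr0 n) (jumpKernelPow_nonneg hd hβ0 hβ1 n x y))
  by_cases hxy : x = y
  · subst hxy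
    have h0 := le_hasSum h 0 fun n _ => hnn n
    have : jumpKernelPow d β 0 x x = 1 := by simp [jumpKernelPow]
    rw [this, pow_zero, mul_one, mul_one] at h0
    exact lt_of_lt_of_le hc h0
  · have h1 := le_hasSum h 1 fun n _ => hnn n
    have hP1 : jumpKernelPow d β 1 x y = jumpKernel d β x y := by
      have e := hasSum_jumpKernelPow_succ_right hd hβ0 hβ1 0 x y
      have e' : HasSum (fun u => jumpKernelPow d β 0 x u * jumpKernel d β u y) (jumpKernel d β x y) := by
        have : (fun u => jumpKernelPow d β 0 x u * jumpKernel d β u y) =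
            fun u => if u = x then jumpKernel d β x y else 0 := by
          funext u
          simp only [jumpKernelPow]
          by_cases hu : u = x
          · subst hu; simp
          · rw [if_neg hu, if_neg (Ne.symm hu), zero_mul]
        rw [this]
        exact hasSum_ite_eq x _
      exact e.unique e'
    rw [hP1, pow_one] at h1
    exact lt_of_lt_of_le (mul_pos hc (mul_pos hrpos (jumpKernel_pos hd hβ0 hβ1 hxy))) h1

/-- **Row sums of the resolvent: `Σ_y ((-Δ)^β + m²)⁻¹_{x,y} = 1/m²`** — the `ℤ^d` form of
"`((-Δ)^β + m²)⁻¹𝟙 = m⁻²𝟙`" (last display of §2.1.2), here from `Σ_y Pⁿ_{x,y} = 1` and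
`(κ+m²)⁻¹Σ_n rⁿ = 1/m²`. [cite: Slade2017, §2.1.2 (last display)] -/
theorem hasSum_fracResolventZd_row {m2 : ℝ} (hm2 : 0 < m2) (x : Site d) :
    HasSum (fun y => fracResolventZd d β m2 x y) (1 / m2) := by
  have hκ := fracLapDiag_pos hd hβ0 hβ1
  obtain ⟨hr0, hr1⟩ := resolventRatio_lt_one hd hβ0 hβ1 hm2
  set c : ℝ := (fracLaplacianZd d β 0 0 + m2)⁻¹ with hc
  set r : ℝ := fracLaplacianZd d β 0 0 / (fracLaplacianZd d β 0 0 + m2) with hr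
  have hcn : 0 ≤ c := inv_nonneg.2 (by linarith)
  -- rows of the double family `(n, y) ↦ c rⁿ Pⁿ_{x,y}`
  have hrow : ∀ n : ℕ, HasSum (fun y => c * (r ^ n * jumpKernelPow d β n x y)) (c * r ^ n) := by
    intro n
    have := ((hasSum_jumpKernelPow hd hβ0 hβ1 n x).mul_left (r ^ n)).mul_left c
    simpa only [mul_one] using this
  have htot : HasSum (fun n : ℕ => c * r ^ n) (1 / m2) := by
    have h := (hasSum_geometric_of_lt_one hr0 hr1).mul_left c
    have hne : fracLaplacianZd d β 0 0 + m2 ≠ 0 := (add_pos hκ hm2).ne'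
    have e : c * (1 - r)⁻¹ = 1 / m2 := by
      simp only [hc, hr]
      rw [one_sub_div hne, add_sub_cancel_left, inv_div, ← mul_div_assoc, inv_mul_cancel₀ hne]
    rwa [e] at h
  obtain ⟨-, hswap⟩ := hasSum_swap_of_nonneg (f := fun n y => c * (r ^ n * jumpKernelPow d β n x y))
    (fun n y => mul_nonneg hcn (mul_nonneg (pow_nonneg hr0 n) (jumpKernelPow_nonneg hd hβ0 hβ1 n x y)))
    hrow htot
  refine hswap.congr_fun fun y => ?_
  exact ((hasSum_fracResolventZd hd hβ0 hβ1 hm2 x y).tsum_eq).symm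

/-- Rows of the resolvent are absolutely summable with `ℓ¹` norm `1/m²` (so
`((-Δ)^β + m²)⁻¹ : ℓ^∞(ℤ^d) → ℓ^∞(ℤ^d)`). [cite: Slade2017, §2.1.2 and Lemma 2.2.2 (hypothesis)] -/
theorem summable_abs_fracResolventZd {m2 : ℝ} (hm2 : 0 < m2) (x : Site d) :
    Summable (fun y => |fracResolventZd d β m2 x y|) ∧
      ∑' y, |fracResolventZd d β m2 x y| = 1 / m2 := by
  have h := hasSum_fracResolventZd_row hd hβ0 hβ1 hm2 x
  have he : (fun y => |fracResolventZd d β m2 x y|) = fun y => fracResolventZd d β m2 x y :=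
    funext fun y => abs_of_nonneg (fracResolventZd_nonneg hd hβ0 hβ1 hm2 x y)
  rw [he]
  exact ⟨h.summable, h.tsum_eq⟩

/-- The resolvent is symmetric. [folklore] -/
theorem fracResolventZd_comm (m2 : ℝ) (x y : Site d) :
    fracResolventZd d β m2 x y = fracResolventZd d β m2 y x := by
  unfold fracResolventZd
  congr 1
  exact tsum_congr fun n => by rw [jumpKernelPow_comm hd hβ0 hβ1 n x y]

/-- The resolvent is translation invariant. [folklore] -/
theorem fracResolventZd_add (m2 : ℝ) (x y v : Site d) :
    fracResolventZd d β m2 (x + v) (y + v) = fracResolventZd d β m2 x y := by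
  unfold fracResolventZd
  congr 1
  exact tsum_congr fun n => by rw [jumpKernelPow_add hd hβ0 hβ1 n x y v]

/-- **`((-Δ)^β + m²)((-Δ)^β + m²)⁻¹ = I` on `ℤ^d`**: `Σ_y (((-Δ)^β)_{x,y} + m²δ_{x,y}) R_{y,z} =
δ_{x,z}`, the sum converging absolutely; from `(-Δ)^β + m² = (κ+m²)(I - rP)` and the telescoping
of the Neumann series `(I - rP)Σ_n rⁿPⁿ = I`. [cite: Slade2017, §2.1.2 and §2.2.3] -/
theorem hasSum_fracLaplacianZd_mul_resolvent {m2 : ℝ} (hm2 : 0 < m2) (x z : Site d) :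
    HasSum (fun y => (fracLaplacianZd d β x y + m2 * if x = y then 1 else 0) *
      fracResolventZd d β m2 y z) (if x = z then 1 else 0) := by
  have hκ := fracLapDiag_pos hd hβ0 hβ1
  obtain ⟨hr0, hr1⟩ := resolventRatio_lt_one hd hβ0 hβ1 hm2
  set κ : ℝ := fracLaplacianZd d β 0 0 with hκdef
  set c : ℝ := (κ + m2)⁻¹ with hc
  set r : ℝ := κ / (κ + m2) with hr
  have hrpos : 0 < r := div_pos hκ (by linarith)
  have hcn : 0 ≤ c := inv_nonneg.2 (by linarith)
  have hne : κ + m2 ≠ 0 := (add_pos hκ hm2).ne'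
  -- (a) the `δ` part
  have ha : HasSum (fun y => (if x = y then (1 : ℝ) else 0) * fracResolventZd d β m2 y z)
      (fracResolventZd d β m2 x z) := by
    have : (fun y => (if x = y then (1 : ℝ) else 0) * fracResolventZd d β m2 y z) =
        fun y => if y = x then fracResolventZd d β m2 x z else 0 := by
      funext y
      by_cases h : y = x
      · subst h; simp
      · rw [if_neg h, if_neg (Ne.symm h), zero_mul]
    rw [this]
    exact hasSum_ite_eq x _
  -- (b) the `P` part: `Σ_y P_{x,y} R_{y,z} = r⁻¹ (R_{x,z} - c δ_{x,z})`
  have hb : HasSum (fun y => jumpKernel d β x y * fracResolventZd d β m2 y z)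
      (r⁻¹ * (fracResolventZd d β m2 x z - c * if x = z then 1 else 0)) := by
    -- rows `n` of `(n, y) ↦ c rⁿ P_{x,y} Pⁿ_{y,z}`
    have hrow : ∀ n : ℕ, HasSum (fun y => c * r ^ n * (jumpKernel d β x y * jumpKernelPow d β n y z))
        (c * r ^ n * jumpKernelPow d β (n + 1) x z) :=
      fun n => (hasSum_jumpKernelPow_succ hd hβ0 hβ1 n x z).mul_left _
    -- their total, by shifting the defining series of `R x z`
    have hdef := hasSum_fracResolventZd hd hβ0 hβ1 hm2 x z
    rw [← hκdef] at hdef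
    rw [← hc, ← hr] at hdef
    have hshift := (hasSum_nat_add_iff' 1).2 hdef
    have hP0 : jumpKernelPow d β 0 x z = if x = z then 1 else 0 := by simp [jumpKernelPow]
    simp only [Finset.sum_range_one, pow_zero, one_mul, hP0] at hshift
    have htot : HasSum (fun n : ℕ => c * r ^ n * jumpKernelPow d β (n + 1) x z)
        (r⁻¹ * (fracResolventZd d β m2 x z - c * if x = z then 1 else 0)) := by
      have h2 := hshift.mul_left r⁻¹
      refine h2.congr_fun fun n => ?_
      rw [pow_succ]
      field_simp
    obtain ⟨-, hswap⟩ := hasSum_swap_of_nonneg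
      (f := fun n y => c * r ^ n * (jumpKernel d β x y * jumpKernelPow d β n y z))
      (fun n y => mul_nonneg (mul_nonneg hcn (pow_nonneg hr0 n))
        (mul_nonneg (jumpKernel_nonneg hd hβ0 hβ1 x y) (jumpKernelPow_nonneg hd hβ0 hβ1 n y z)))
      hrow htot
    refine hswap.congr_fun fun y => ?_
    have hy := hasSum_fracResolventZd hd hβ0 hβ1 hm2 y z
    rw [← hκdef] at hy
    rw [← hc, ← hr] at hy
    rw [← hy.tsum_eq, ← tsum_mul_left]
    exact tsum_congr fun n => by ring
  -- combine: `T + m² = (κ+m²)δ - κP`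
  have hcomb := (ha.mul_left (κ + m2)).sub (hb.mul_left κ)
  have hval : (κ + m2) * fracResolventZd d β m2 x z -
      κ * (r⁻¹ * (fracResolventZd d β m2 x z - c * if x = z then 1 else 0)) =
      if x = z then 1 else 0 := by
    simp only [hc, hr]
    field_simp
    ring
  rw [hval] at hcomb
  refine hcomb.congr_fun fun y => ?_
  rw [fracLaplacianZd_eq_kappa hd hβ0 hβ1 x y]
  ring

/-- **`((-Δ)^β + m²)⁻¹((-Δ)^β + m²) = I` on `ℤ^d`** (by the symmetry of both factors).
[cite: Slade2017, §2.1.2 and §2.2.3] -/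
theorem hasSum_resolvent_mul_fracLaplacianZd {m2 : ℝ} (hm2 : 0 < m2) (x z : Site d) :
    HasSum (fun y => fracResolventZd d β m2 x y *
      (fracLaplacianZd d β y z + m2 * if y = z then 1 else 0)) (if x = z then 1 else 0) := by
  have h := hasSum_fracLaplacianZd_mul_resolvent hd hβ0 hβ1 hm2 z x
  have e : (if z = x then (1 : ℝ) else 0) = if x = z then 1 else 0 := by
    by_cases hxz : x = z
    · subst hxz; rfl
    · rw [if_neg hxz, if_neg (Ne.symm hxz)]
  rw [e] at h
  refine h.congr_fun fun y => ?_
  rw [fracResolventZd_comm hd hβ0 hβ1 m2 x y, fracLaplacianZd_comm d β y z, mul_comm]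
  by_cases hyz : y = z
  · subst hyz; simp
  · rw [if_neg hyz, if_neg (Ne.symm hyz)]

end Resolvent

/-! ### §2.2.3, display (2.19): the torus resolvent is the periodised `ℤ^d` resolvent -/

/-- `(-Δ)^β + m²` on `ℤ^d` periodises to `C⁻¹ = (-Δ_Λ)^β + m²` on the torus.
[cite: Slade2017, §2.2.3 (Lemma 2.2.2 applied with T = (-Δ)^β + m²)] -/
theorem periodise_fracLaplacianZd_add_mass (hd : 1 ≤ d) {β : ℝ} (hβ0 : 0 < β) (hβ1 : β < 1)
    {M : ℕ} [NeZero M] (m2 : ℝ) (x y : TorusSite d M) :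
    periodise M (fun a b => fracLaplacianZd d β a b + m2 * if a = b then 1 else 0) x y =
      covInvMatrix d β M m2 x y := by
  have h1 : Summable fun w => fracLaplacianZd d β (fun j => ((x j).val : ℤ)) w :=
    (summable_abs_fracLaplacianZd hd hβ0 hβ1 _).of_abs
  have h2 : Summable fun w : Site d =>
      m2 * if (fun j => ((x j).val : ℤ)) = w then (1 : ℝ) else 0 := by
    refine (hasSum_ite_eq (fun j => ((x j).val : ℤ)) m2).summable.congr fun w => ?_
    by_cases h : w = (fun j => ((x j).val : ℤ))
    · subst h; simp
    · rw [if_neg h, if_neg (Ne.symm h), mul_zero]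
  rw [periodise_add (fun a b => fracLaplacianZd d β a b) (fun a b => m2 * if a = b then (1 : ℝ) else 0)
      x y h1 h2,
    periodise_const_mul m2 (fun a b : Site d => if a = b then (1 : ℝ) else 0) x y, periodise_delta,
    covInvMatrix_apply, fracLaplacianTorus_eq_periodise]
  by_cases hxy : x = y
  · rw [if_pos hxy, if_pos hxy, mul_one]
  · rw [if_neg hxy, if_neg hxy, mul_zero]

/-- **Slade, display (2.19), PROVED: the torus resolvent is the periodisation of the `ℤ^d`
resolvent**, `((-Δ_Λ)^β + m²)⁻¹_{x,y} = Σ_{z∈ℤ^d} ((-Δ_{ℤ^d})^β + m²)⁻¹_{x̃, ỹ+Mz}` — Lemma 2.2.2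
applied with `T = (-Δ)^β + m²` (for `d ≥ 1`, `β ∈ (0,1)`, `m² > 0`, any period `M ≥ 1`).
[cite: Slade2017, §2.2.3 display (2.19) (second line) and Lemma 2.2.2] -/
theorem Slade2017_torusResolvent (hd : 1 ≤ d) {β : ℝ} (hβ0 : 0 < β) (hβ1 : β < 1)
    {M : ℕ} [NeZero M] {m2 : ℝ} (hm2 : 0 < m2) :
    (covInvMatrix d β M m2)⁻¹ = Matrix.of (periodise M (fracResolventZd d β m2)) := by
  set T : Site d → Site d → ℝ := fun a b => fracLaplacianZd d β a b + m2 * if a = b then 1 else 0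
    with hT
  have hTinv : ∀ x y v, T (x + v) (y + v) = T x y := by
    intro x y v
    simp only [hT, fracLaplacianZd_add]
    by_cases h : x = y
    · subst h; simp
    · rw [if_neg h, if_neg fun h' => h (add_right_cancel h')]
  have hTrow : Summable fun y => |T 0 y| := by
    have h1 : Summable fun y => |fracLaplacianZd d β 0 y| := summable_abs_fracLaplacianZd hd hβ0 hβ1 0
    have h2 : Summable fun y : Site d => |m2 * if (0 : Site d) = y then (1 : ℝ) else 0| := by
      refine (hasSum_ite_eq (0 : Site d) |m2|).summable.congr fun w => ?_
      by_cases h : w = 0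
      · subst h; simp
      · rw [if_neg h, if_neg (Ne.symm h), mul_zero, abs_zero]
    refine Summable.of_nonneg_of_le (fun y => abs_nonneg _) (fun y => ?_) (h1.add h2)
    simp only [hT]
    exact abs_add_le _ _
  obtain ⟨hSrow, hSB⟩ : (∀ x, Summable fun y => |fracResolventZd d β m2 x y|) ∧
      ∀ x, ∑' y, |fracResolventZd d β m2 x y| ≤ 1 / m2 :=
    ⟨fun x => (summable_abs_fracResolventZd hd hβ0 hβ1 hm2 x).1,
      fun x => (summable_abs_fracResolventZd hd hβ0 hβ1 hm2 x).2.le⟩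
  have hTS : ∀ x z, HasSum (fun y => T x y * fracResolventZd d β m2 y z) (if x = z then 1 else 0) :=
    fun x z => hasSum_fracLaplacianZd_mul_resolvent hd hβ0 hβ1 hm2 x z
  have hST : ∀ x z, HasSum (fun y => fracResolventZd d β m2 x y * T y z) (if x = z then 1 else 0) :=
    fun x z => hasSum_resolvent_mul_fracLaplacianZd hd hβ0 hβ1 hm2 x z
  obtain ⟨hmul, -⟩ := Slade2017_lem222 (M := M) T (fracResolventZd d β m2) hTinv hTrow hSrow hSB hTS hST
  have hper : Matrix.of (periodise M T) = covInvMatrix d β M m2 := by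
    ext x y
    simp only [Matrix.of_apply, hT]
    exact periodise_fracLaplacianZd_add_mass hd hβ0 hβ1 m2 x y
  rw [hper] at hmul
  exact Matrix.inv_eq_right_inv hmul

/-- **Entries of the torus covariance `C = ((-Δ_Λ)^β + m²)⁻¹` are positive** (each is a sum of
positive entries of the `ℤ^d` resolvent). [cite: Slade2017, §2.2.3 display (2.19)] -/
theorem covInvMatrix_inv_pos (hd : 1 ≤ d) {β : ℝ} (hβ0 : 0 < β) (hβ1 : β < 1) {M : ℕ}
    [NeZero M] {m2 : ℝ} (hm2 : 0 < m2) (x y : TorusSite d M) :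
    0 < (covInvMatrix d β M m2)⁻¹ x y := by
  rw [Slade2017_torusResolvent hd hβ0 hβ1 hm2, Matrix.of_apply]
  have h := hasSum_periodise (fracResolventZd d β m2) x y
    (summable_abs_fracResolventZd hd hβ0 hβ1 hm2 _).1.of_abs
  have hle := le_hasSum h 0 fun z _ => (fracResolventZd_pos hd hβ0 hβ1 hm2 _ _).le
  exact lt_of_lt_of_le (fracResolventZd_pos hd hβ0 hβ1 hm2 _ _) hle

/-- Row sums of the torus covariance, recovered from (2.19): `Σ_y C_{x,y} = 1/m²` (the torus
form of `((-Δ)^β+m²)⁻¹𝟙 = m⁻²𝟙`, consistent with `covInvMatrix_inv_mulVec_one`).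
[cite: Slade2017, §2.1.2 (last display) and §2.2.3] -/
theorem sum_covInvMatrix_inv (hd : 1 ≤ d) {β : ℝ} (hβ0 : 0 < β) (hβ1 : β < 1) {M : ℕ}
    [NeZero M] {m2 : ℝ} (hm2 : 0 < m2) (x : TorusSite d M) :
    ∑ y, (covInvMatrix d β M m2)⁻¹ x y = 1 / m2 := by
  have h := congr_fun (covInvMatrix_inv_mulVec_one hd hβ0 hβ1 hm2 (M := M)) x
  simp only [Matrix.mulVec, dotProduct, mul_one] at h
  rw [h, one_div]

end LongRangePhi4

end Literature.Barriers.CriticalPhenomena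

end
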